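import Summits.AtomisticToContinuum.Crystallization.Theorems.ChartedZeroExcessLayeredLatticeLiouvilleZZF

/-!
# Part ZZG «ConePins — the pin checker, index side» (lens-2 g80; (B′.3a) of the REACH DESIGN, critic rows 1447 (B)(3) / 1454)

The cone pin at a shallow site `x` (memo `g80/memo/Bprime-reach.md` §3–§4) reads, on the INDEX side: the unknown site `x* := Θ⁻¹ (g x)` is
`BarlowAdj`-adjacent to every pinned first-shell member and `BarlowFour`-related (Part ZZF) to every pinned second-shell member; the pin
CERTIFICATE (B′.3b) must conclude `x* = x` or `x* ∈ A` (an explicit list of «allowed competitors», themselves pinned).  This rider is the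
generic, letter-context-independent machinery that turns that conclusion into ONE closed `Bool` evaluation per certificate cell:

* §1 WINDOW TRANSPORT with a letter FUNCTION: `barlowAdj_add_iff` — `BarlowAdj τ (v + y) (v + y') ↔ BarlowAdj (fun m ↦ τ (v.1 + m)) y y'` for ALL
  offsets (Part ZU's `barlowAdj_shift_iff` is the three-sheet special case with two letters), and the same for `BarlowFour` (`barlowFour_of_add`).
* §2 `Bool` EVALUATORS over a letter function `ℓ : ℤ → Bool`: `barlowAdjB` (`barlowAdjB_iff`), the common-neighbour count `commonCount` through the
  coded link `linkPt` of the member (Parts ZU/ZV: `linkSite`, `exists_linkPt_of_barlowAdj`, Part ZZ `linkPt_injective`), and `fourB` with its SOUNDNESS `fourB_of_barlowFour` (a 4-set of common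
  neighbours injects into the twelve codes of the member's link).
* §3 LETTER LOCALITY: adjacency / `BarlowFour` between sites of the five-sheet window `{−2,…,2} × ℤ²` read the letter function only on `{−2,…,1}`
  (`barlowAdj_letters_congr`, `barlowFour_letters_congr`), so the four letters `letters4 a b c d` (steps `−2→−1`, `−1→0`, `0→1`, `1→2`) decide everything.
* §4 ★ THE PIN CHECKER `pinCheckB a b c d σ₁ σ₂ A : Bool` (candidates = the twelve coded link sites of the first listed first-shell member; for each:
  all adjacency constraints ∧ all Four constraints ⇒ candidate `= 0` ∨ `∈ A`) and its SOUNDNESS `pin_sound` (relative, any letter function agreeing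
  with `letters4 a b c d` on `{−2,…,1}`) and `pin_sound_abs` (absolute: letters `τ`, centre `v`, members `v + s`).
  
Pure combinatorics over Parts ZH/ZU/ZV/ZZF; no metric, no door-set hypothesis; 0 sorry.  The certificate cells (B′.3b) instantiate `pinCheckB` by
`decide`, one lemma per letter context and cube face (row 1454 (3): no merged decides, no `native_decide`).
-/

namespace Summit.AtomisticToContinuum.Crystallization.Theorems.ChartedZeroExcessLayeredLatticeLiouville

/-! ## ZZG-1  Window transport with a letter function -/

/-- in-sheet adjacency is translation invariant. [formal bookkeeping] -/
private theorem loAdj_add_left' (c p q : ℤ × ℤ) : LoAdj (c + p) (c + q) ↔ LoAdj p q := by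
  simp [LoAdj, add_assoc]

/-- ★ Barlow adjacency of two sites placed at `v` is Barlow adjacency of the offsets for the SHIFTED LETTER FUNCTION `m ↦ τ (v.1 + m)` — for all
offsets (the five-sheet window of the pin checker included). [this file, g80] -/
theorem barlowAdj_add_iff (τ : ℤ → Bool) (v y y' : ℤ × ℤ × ℤ) :
    BarlowAdj τ (v + y) (v + y') ↔ BarlowAdj (fun m => τ (v.1 + m)) y y' := by
  obtain ⟨k, c⟩ := v
  obtain ⟨a, p⟩ := y
  obtain ⟨a', p'⟩ := y'
  have e1 : (k + a' = k + a) ↔ (a' = a) := by constructor <;> intro h <;> omega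
  have e2 : (k + a' = k + a + 1) ↔ (a' = a + 1) := by constructor <;> intro h <;> omega
  have e3 : (k + a = k + a' + 1) ↔ (a = a' + 1) := by constructor <;> intro h <;> omega
  simp only [BarlowAdj, Prod.fst_add, Prod.snd_add, loAdj_add_left', crossAdj_add_left, e1, e2, e3]

/-- `BarlowFour` (Part ZZF) transports the same way (the direction the pin checker consumes). [this file, g80] -/
theorem barlowFour_of_add {τ : ℤ → Bool} {v y y' : ℤ × ℤ × ℤ} (h : BarlowFour τ (v + y) (v + y')) :
    BarlowFour (fun m => τ (v.1 + m)) y y' := by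
  obtain ⟨hne, hnadj, T, hT, hTz⟩ := h
  refine ⟨fun e => hne (by rw [e]), fun h' => hnadj ((barlowAdj_add_iff τ v y y').2 h'), T.image (fun z => z - v), ?_, ?_⟩
  · rwa [Finset.card_image_of_injective _ (sub_left_injective)]
  · intro z hz
    obtain ⟨z₀, hz₀, rfl⟩ := Finset.mem_image.1 hz
    have e : v + (z₀ - v) = z₀ := by abel
    obtain ⟨h1, h2⟩ := hTz z₀ hz₀
    exact ⟨(barlowAdj_add_iff τ v y (z₀ - v)).1 (by rwa [e]), (barlowAdj_add_iff τ v y' (z₀ - v)).1 (by rwa [e])⟩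

/-! ## ZZG-2  `Bool` evaluators over a letter function -/

/-- `BarlowAdj ℓ` as a `Bool`, for a letter function `ℓ`. [this file, g80] -/
def barlowAdjB (ℓ : ℤ → Bool) (x y : ℤ × ℤ × ℤ) : Bool :=
  (y.1 = x.1 && loAdjB x.2 y.2) || (y.1 = x.1 + 1 && crossAdjB (ℓ x.1) x.2 y.2) || (x.1 = y.1 + 1 && crossAdjB (ℓ y.1) y.2 x.2)

/-- [formal bookkeeping] -/
theorem barlowAdjB_iff (ℓ : ℤ → Bool) (x y : ℤ × ℤ × ℤ) : barlowAdjB ℓ x y = true ↔ BarlowAdj ℓ x y := by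
  simp only [barlowAdjB, BarlowAdj, Bool.or_eq_true, Bool.and_eq_true, decide_eq_true_eq, loAdjB_iff, crossAdjB_iff, or_assoc]

/-- the number of coded link sites of `m` adjacent to `x`: the common-neighbour count of `x` and `m`. [this file, g80] -/
def commonCount (ℓ : ℤ → Bool) (x m : ℤ × ℤ × ℤ) : ℕ :=
  (Finset.univ.filter fun i : Fin 12 => barlowAdjB ℓ x (linkPt ℓ m i) = true).card

/-- `BarlowFour ℓ x m` as a `Bool`: `x ≠ m`, not adjacent, at least four common neighbours. [this file, g80] -/
def fourB (ℓ : ℤ → Bool) (x m : ℤ × ℤ × ℤ) : Bool :=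
  decide (x ≠ m) && !barlowAdjB ℓ x m && decide (4 ≤ commonCount ℓ x m)

/-- ★ SOUNDNESS of `fourB`: a `BarlowFour` pair passes the `Bool` test (its ≥ 4 common neighbours are coded link sites of `m`, injectively).
[this file, g80] -/
theorem fourB_of_barlowFour {ℓ : ℤ → Bool} {x m : ℤ × ℤ × ℤ} (h : BarlowFour ℓ x m) : fourB ℓ x m = true := by
  obtain ⟨hne, hnadj, T, hT, hTz⟩ := h
  have hcount : 4 ≤ commonCount ℓ x m := by
    classical
    choose! code hcode using fun z (hz : z ∈ T) => exists_linkPt_of_barlowAdj (hTz z hz).2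
    have hinj : Set.InjOn code ↑T := by
      intro z hz z' hz' e
      rw [hcode z hz, hcode z' hz', e]
    have hmaps : ∀ z ∈ T, code z ∈ Finset.univ.filter fun i : Fin 12 => barlowAdjB ℓ x (linkPt ℓ m i) = true := by
      intro z hz
      simp only [Finset.mem_filter, Finset.mem_univ, true_and, barlowAdjB_iff, ← hcode z hz]
      exact (hTz z hz).1
    calc 4 ≤ T.card := hT
      _ ≤ _ := Finset.card_le_card_of_injOn code hmaps hinj
  have h1 : barlowAdjB ℓ x m = false := by
    rw [Bool.eq_false_iff]
    exact fun h' => hnadj ((barlowAdjB_iff ℓ x m).1 h')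
  simp [fourB, hne, h1, hcount]

/-! ## ZZG-3  Letter locality on the five-sheet window -/

/-- the letter function of a four-letter context: steps `−2 → −1`, `−1 → 0`, `0 → 1`, `1 → 2`. [this file, g80] -/
def letters4 (a b c d : Bool) : ℤ → Bool := fun m => if m = -2 then a else if m = -1 then b else if m = 0 then c else d

/-- the shifted letter function of `τ` at `v` agrees with `letters4 (τ (v.1 − 2)) (τ (v.1 − 1)) (τ v.1) (τ (v.1 + 1))` on `{−2, …, 1}`. [formal bookkeeping] -/
theorem letters4_shift (τ : ℤ → Bool) (v : ℤ × ℤ × ℤ) (m : ℤ) (h1 : -2 ≤ m) (h2 : m ≤ 1) :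
    (fun m => τ (v.1 + m)) m = letters4 (τ (v.1 - 2)) (τ (v.1 - 1)) (τ v.1) (τ (v.1 + 1)) m := by
  simp only [letters4]
  rcases (by omega : m = -2 ∨ m = -1 ∨ m = 0 ∨ m = 1) with rfl | rfl | rfl | rfl <;> simp <;> ring_nf

/-- adjacency on the five-sheet window reads the letters on `{−2,…,1}` only. [this file, g80] -/
theorem barlowAdj_letters_congr {ℓ ℓ' : ℤ → Bool} (h : ∀ m : ℤ, -2 ≤ m → m ≤ 1 → ℓ m = ℓ' m) {y y' : ℤ × ℤ × ℤ}
    (hy : -2 ≤ y.1) (hy2 : y.1 ≤ 2) (hy' : -2 ≤ y'.1) (hy'2 : y'.1 ≤ 2) : BarlowAdj ℓ y y' ↔ BarlowAdj ℓ' y y' := by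
  simp only [BarlowAdj]
  constructor
  · rintro (h0 | ⟨h1, h2⟩ | ⟨h1, h2⟩)
    · exact Or.inl h0
    · exact Or.inr (Or.inl ⟨h1, by rwa [← h y.1 hy (by omega)]⟩)
    · exact Or.inr (Or.inr ⟨h1, by rwa [← h y'.1 hy' (by omega)]⟩)
  · rintro (h0 | ⟨h1, h2⟩ | ⟨h1, h2⟩)
    · exact Or.inl h0
    · exact Or.inr (Or.inl ⟨h1, by rwa [h y.1 hy (by omega)]⟩)
    · exact Or.inr (Or.inr ⟨h1, by rwa [h y'.1 hy' (by omega)]⟩)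

/-- adjacent sites are on the same or consecutive sheets. [formal bookkeeping] -/
theorem fst_near_of_barlowAdj {ℓ : ℤ → Bool} {y y' : ℤ × ℤ × ℤ} (h : BarlowAdj ℓ y y') : y.1 - 1 ≤ y'.1 ∧ y'.1 ≤ y.1 + 1 := by
  rcases h with ⟨h1, -⟩ | ⟨h1, -⟩ | ⟨h1, -⟩ <;> constructor <;> omega

/-- `BarlowFour` between a site of the window and a site of the three inner sheets reads the letters on `{−2,…,1}` only. [this file, g80] -/
theorem barlowFour_letters_congr {ℓ ℓ' : ℤ → Bool} (h : ∀ m : ℤ, -2 ≤ m → m ≤ 1 → ℓ m = ℓ' m) {y y' : ℤ × ℤ × ℤ}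
    (hy : -2 ≤ y.1) (hy2 : y.1 ≤ 2) (hy' : -1 ≤ y'.1) (hy'2 : y'.1 ≤ 1) (hf : BarlowFour ℓ y y') : BarlowFour ℓ' y y' := by
  obtain ⟨hne, hnadj, T, hT, hTz⟩ := hf
  refine ⟨hne, fun h' => hnadj ((barlowAdj_letters_congr h hy hy2 (by omega) (by omega)).2 h'), T, hT, fun z hz => ?_⟩
  obtain ⟨h1, h2⟩ := hTz z hz
  have hz1 := fst_near_of_barlowAdj h2
  exact ⟨(barlowAdj_letters_congr h hy hy2 (by omega) (by omega)).1 h1, (barlowAdj_letters_congr h (by omega) (by omega) (by omega) (by omega)).1 h2⟩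

/-! ## ZZG-4  The pin checker and its soundness -/

/-- ★ THE PIN CHECKER of a certificate cell.  Letters `a b c d` (steps `−2→−1, −1→0, 0→1, 1→2` around the pinned site at the origin), first-shell
members `σ₁` and second-shell members `σ₂` (RELATIVE sites), allowed competitors `A`.  Candidates for `x*` are the twelve coded link sites of the
first listed first-shell member; the cell passes iff every candidate adjacent to all of `σ₁` and Four-related to all of `σ₂` is `0` or listed in `A`.
[this file, g80] -/
def pinCheckB (a b c d : Bool) (σ₁ σ₂ A : List (ℤ × ℤ × ℤ)) : Bool :=
  match σ₁ with
  | [] => false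
  | s :: rest => (List.finRange 12).all fun i =>
      !((s :: rest).all fun m => barlowAdjB (letters4 a b c d) (linkPt (letters4 a b c d) s i) m) ||
      !(σ₂.all fun m' => fourB (letters4 a b c d) (linkPt (letters4 a b c d) s i) m') ||
      decide (linkPt (letters4 a b c d) s i = 0) || decide (linkPt (letters4 a b c d) s i ∈ A)

/-- ★★ SOUNDNESS OF THE PIN CHECKER (relative form).  If the cell passes, then for ANY letter function `ℓ` agreeing with the four letters on
`{−2,…,1}` and any site `x` adjacent to all first-shell members (listed on sheets `−1,0,1`) and Four-related to all second-shell members (listed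
on sheets `−1,0,1`), `x = 0` or `x ∈ A`. [this file, g80] -/
theorem pin_sound {a b c d : Bool} {σ₁ σ₂ A : List (ℤ × ℤ × ℤ)} (hpin : pinCheckB a b c d σ₁ σ₂ A = true)
    (hσ₁ : ∀ m ∈ σ₁, -1 ≤ m.1 ∧ m.1 ≤ 1) (hσ₂ : ∀ m ∈ σ₂, -1 ≤ m.1 ∧ m.1 ≤ 1)
    {ℓ : ℤ → Bool} (hℓ : ∀ m : ℤ, -2 ≤ m → m ≤ 1 → ℓ m = letters4 a b c d m)
    {x : ℤ × ℤ × ℤ} (h1 : ∀ m ∈ σ₁, BarlowAdj ℓ x m) (h2 : ∀ m' ∈ σ₂, BarlowFour ℓ x m') : x = 0 ∨ x ∈ A := by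
  match σ₁, hpin, hσ₁, h1 with
  | [], hpin, _, _ => simp [pinCheckB] at hpin
  | s :: rest, hpin, hσ₁, h1 =>
    set L := letters4 a b c d with hL
    have hs := hσ₁ s (by simp)
    -- `x` is a coded link site of `s`, for the letters `L`
    have hadj : BarlowAdj L s x := by
      have := barlowAdj_symm (h1 s (by simp))
      have hx1 := fst_near_of_barlowAdj this
      exact (barlowAdj_letters_congr hℓ (by omega) (by omega) (by omega) (by omega)).1 this
    obtain ⟨i, hi⟩ := exists_linkPt_of_barlowAdj hadj
    have hx1 : -2 ≤ x.1 ∧ x.1 ≤ 2 := by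
      have := fst_near_of_barlowAdj hadj; constructor <;> omega
    -- unpack the checker at the candidate `i`
    simp only [pinCheckB, List.all_eq_true, Bool.or_eq_true, Bool.not_eq_true', decide_eq_true_eq] at hpin
    have hpi := hpin i (List.mem_finRange i)
    rw [← hi] at hpi
    rcases hpi with ((hA | hF) | h0) | hmem
    · exfalso
      rw [Bool.eq_false_iff, ne_eq, List.all_eq_true] at hA
      refine hA fun m hm => ?_
      have hm1 := hσ₁ m hm
      rw [barlowAdjB_iff]
      exact (barlowAdj_letters_congr hℓ hx1.1 hx1.2 (by omega) (by omega)).1 (h1 m hm)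
    · exfalso
      rw [Bool.eq_false_iff, ne_eq, List.all_eq_true] at hF
      refine hF fun m' hm' => ?_
      have hm1 := hσ₂ m' hm'
      exact fourB_of_barlowFour (barlowFour_letters_congr hℓ hx1.1 hx1.2 hm1.1 hm1.2 (h2 m' hm'))
    · exact Or.inl h0
    · exact Or.inr hmem

/-- ★★ SOUNDNESS, ABSOLUTE FORM.  Letters `τ`, pinned site `v`; the members are the placed sites `v + s`; the candidate `x*` is any site adjacent to
all first-shell members and `BarlowFour`-related to all second-shell members; conclusion `x* = v` or `x* − v ∈ A`. [this file, g80] -/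
theorem pin_sound_abs {τ : ℤ → Bool} {v : ℤ × ℤ × ℤ} {σ₁ σ₂ A : List (ℤ × ℤ × ℤ)}
    (hpin : pinCheckB (τ (v.1 - 2)) (τ (v.1 - 1)) (τ v.1) (τ (v.1 + 1)) σ₁ σ₂ A = true)
    (hσ₁ : ∀ m ∈ σ₁, -1 ≤ m.1 ∧ m.1 ≤ 1) (hσ₂ : ∀ m ∈ σ₂, -1 ≤ m.1 ∧ m.1 ≤ 1)
    {x : ℤ × ℤ × ℤ} (h1 : ∀ s ∈ σ₁, BarlowAdj τ x (v + s)) (h2 : ∀ s ∈ σ₂, BarlowFour τ x (v + s)) : x = v ∨ x - v ∈ A := by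
  have e : v + (x - v) = x := by abel
  have h1' : ∀ s ∈ σ₁, BarlowAdj (fun m => τ (v.1 + m)) (x - v) s := fun s hs =>
    (barlowAdj_add_iff τ v (x - v) s).1 (by rw [e]; exact h1 s hs)
  have h2' : ∀ s ∈ σ₂, BarlowFour (fun m => τ (v.1 + m)) (x - v) s := fun s hs =>
    barlowFour_of_add (by rw [e]; exact h2 s hs)
  rcases pin_sound hpin hσ₁ hσ₂ (letters4_shift τ v) h1' h2' with h | h
  · exact Or.inl (by rw [← e, h, add_zero])
  · exact Or.inr h

end Summit.AtomisticToContinuum.Crystallization.Theorems.ChartedZeroExcessLayeredLatticeLiouville
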